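import Mathlib.Topology.Algebra.Group.Pointwise
import Mathlib.Data.Fintype.Pi
import Mathlib.Data.Finite.Prod
import HarnessLib

/-!
# Covers by translates of a Siegel set: free indices and finitely many orbits of simplices

Topic `NumberTheory/Automorphic`; namespace `Literature.NumberTheory.Automorphic`, grouping
sub-namespace `SiegelCover`.  Theorems only, abstract group theory / point-set topology.

The setting abstracts the reduction theory of an arithmetic group ([Borel1969, §13, §15];
Godement, Sém. Bourbaki 257 §10 [BorelEtAl2020]): a group `G` (rational points) with two
homomorphisms `θ : G →* H` (archimedean component, `H` acting on a space `X` with base point `x₀`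
whose stabiliser is the subgroup `Kc`, the action being transitive) and `f : G →* Gf`
(finite-adelic component, `Gf` a topological group), a compact open subgroup `U ≤ Gf`
(so that `f⁻¹(U)` is the congruence subgroup) and a "Siegel set" `𝔖 ⊆ H`.  The two inputs are

* the *fundamental set* property `hcovH`: for some compact `Q ⊆ Gf`, every `h : H` is
  `θ γ * b * k` with `f γ ∈ Q`, `b ∈ 𝔖`, `k ∈ Kc`;
* the *Siegel property* `hfinH`: for every compact `Q ⊆ Gf` only finitely many `γ` with
  `f γ ∈ Q` satisfy `θ γ 𝔖 ∩ 𝔖 Kc ≠ ∅`.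

The output (`exists_cover_data_of_fundamentalSet_of_siegelProperty`) is the combinatorial datum
needed to build a cofinite free equivariant cover of `X` by translates `θ γ • 𝔖 • x₀` indexed by
`ι = {γ : f γ ∈ U Q}`: (a) these translates cover `X`; (b) in each degree `p` there is a finite
set `S` of `(p+1)`-tuples of indices such that every tuple `J` of indices whose translates have a
common point is a left translate `g J₀` of some `J₀ ∈ S` by some `g` with `f g ∈ U`.

The proof of (b): `U Q` is compact and covered by the open cosets `U y`, so finitely many
`G`-representatives `ρ` of the cosets `U (f γ)` suffice (`exists_finite_rightCosetReps`); the ratios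
`(J 0)⁻¹ J k` of a tuple with a common point lie in the finite set provided by the Siegel property
for the compact set `(U Q)⁻¹ (U Q)`; and `J = g J₀` with `g = J 0 ρ⁻¹`, `J₀ k = ρ (J 0)⁻¹ J k`.

## References

* A. Borel, *Introduction aux groupes arithmétiques*, Hermann (1969), §13 (ensembles
  fondamentaux), §15 (propriété de Siegel) [Borel1969].
* R. Godement, *Domaines fondamentaux des groupes arithmétiques*, Sém. Bourbaki 257, §10 Thm. 9,
  in [BorelEtAl2020].
-/

open scoped Pointwise

namespace Literature.NumberTheory.Automorphic

namespace SiegelCover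

/-- **Finitely many coset representatives over a compact set.**  If `U` is an open subgroup of
the topological group `Gf`, `K ⊆ Gf` is compact and `f : G →* Gf` is a homomorphism, then there
is a finite set `R₀ ⊆ G` such that every `γ : G` with `f γ ∈ K` satisfies `f (γ ρ⁻¹) ∈ U` for
some `ρ ∈ R₀` (i.e. `U (f γ) = U (f ρ)`): the compact set `K` meets only finitely many of the
open right cosets `U y`. [folklore] -/
theorem exists_finite_rightCosetReps
    {G Gf : Type*} [Group G] [Group Gf] [TopologicalSpace Gf] [IsTopologicalGroup Gf]
    (f : G →* Gf) (U : Subgroup Gf) (hUo : IsOpen (U : Set Gf)) {K : Set Gf}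
    (hK : IsCompact K) :
    ∃ R₀ : Set G, R₀.Finite ∧ ∀ γ : G, f γ ∈ K → ∃ ρ ∈ R₀, f (γ * ρ⁻¹) ∈ U := by
  classical
  -- finitely many open cosets `U y` cover the compact set `K`
  obtain ⟨F, hF⟩ := hK.elim_finite_subcover (fun y : Gf => (U : Set Gf) * {y})
    (fun _ => hUo.mul_right)
    (fun y hy => Set.mem_iUnion.2 ⟨y, Set.mem_mul.2 ⟨1, U.one_mem, y, rfl, one_mul y⟩⟩)
  -- choose a representative in `G` of each coset that meets `f G`
  have hch : ∀ y : Gf, ∃ r : G, (∃ r' : G, f r' ∈ (U : Set Gf) * {y}) →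
      f r ∈ (U : Set Gf) * {y} := by
    intro y
    by_cases h : ∃ r' : G, f r' ∈ (U : Set Gf) * {y}
    · obtain ⟨r, hr⟩ := h
      exact ⟨r, fun _ => hr⟩
    · exact ⟨1, fun h' => (h h').elim⟩
  choose ρ hρ using hch
  refine ⟨ρ '' (F : Set Gf), (F.finite_toSet).image ρ, fun γ hγ => ?_⟩
  obtain ⟨y, hyF, hγy⟩ := Set.mem_iUnion₂.1 (hF hγ)
  refine ⟨ρ y, Set.mem_image_of_mem ρ hyF, ?_⟩
  obtain ⟨u, hu, y', hy', huy⟩ := Set.mem_mul.1 hγy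
  obtain ⟨u', hu', y'', hy'', huy'⟩ := Set.mem_mul.1 (hρ y ⟨γ, hγy⟩)
  rw [Set.mem_singleton_iff.1 hy'] at huy
  rw [Set.mem_singleton_iff.1 hy''] at huy'
  rw [map_mul, map_inv, ← huy, ← huy', mul_inv_rev, mul_assoc, mul_inv_cancel_left]
  exact U.mul_mem hu (U.inv_mem hu')

/-- **Fundamental set + Siegel property ⇒ free translate cover with finitely many orbits of
nerve simplices** (abstract form of [Borel1969, §13, §15]; Godement, Sém. Bourbaki 257 §10).
Let `θ : G →* H`, `f : G →* Gf`, `U ≤ Gf` compact open, `𝔖 ⊆ H`, `Kc ≤ H` the stabiliser of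
the base point `x₀` of a transitive `H`-space `X`.  Assume the fundamental-set property (every
`h` is `θ γ * b * k`, `f γ` in a fixed compact `Q`, `b ∈ 𝔖`, `k ∈ Kc`) and the Siegel property
(for `f γ` in a compact set only finitely many `γ` have `θ γ * b = b' * k` with `b, b' ∈ 𝔖`,
`k ∈ Kc`).  Then for the same `Q`: (a) the translates `θ γ • 𝔖 • x₀`, `f γ ∈ U Q`, cover `X`;
(b) for every `p` there is a finite set `S` of `(p+1)`-tuples such that every tuple `J` with all
`f (J k) ∈ U Q` whose translates have a common point is `g • J₀` (`g * J₀ k = J k` for all `k`)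
for some `J₀ ∈ S` and some `g` with `f g ∈ U`. [cite: Borel1969, §13 and §15] -/
theorem exists_cover_data_of_fundamentalSet_of_siegelProperty
    {G H Gf X : Type} [Group G] [Group H] [Group Gf] [TopologicalSpace Gf] [IsTopologicalGroup Gf]
    [MulAction H X] (θ : G →* H) (f : G →* Gf) (U : Subgroup Gf)
    (hUo : IsOpen (U : Set Gf)) (hUc : IsCompact (U : Set Gf))
    (𝔖 : Set H) (Kc : Subgroup H) (x₀ : X)
    (hKc : ∀ k ∈ Kc, k • x₀ = x₀) (hstab : ∀ h : H, h • x₀ = x₀ → h ∈ Kc)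
    (htrans : ∀ x : X, ∃ h : H, h • x₀ = x)
    (hcovH : ∃ Q : Set Gf, IsCompact Q ∧
      ∀ h : H, ∃ γ : G, f γ ∈ Q ∧ ∃ b ∈ 𝔖, ∃ k ∈ Kc, θ γ * b * k = h)
    (hfinH : ∀ Q : Set Gf, IsCompact Q →
      {γ : G | f γ ∈ Q ∧ ∃ b ∈ 𝔖, ∃ b' ∈ 𝔖, ∃ k ∈ Kc, θ γ * b = b' * k}.Finite) :
    ∃ Q : Set Gf, IsCompact Q ∧
      (∀ x : X, ∃ γ : G, f γ ∈ (U : Set Gf) * Q ∧ ∃ b ∈ 𝔖, θ γ • b • x₀ = x) ∧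
      (∀ p : ℕ, ∃ S : Set (Fin (p + 1) → G), S.Finite ∧
        ∀ J : Fin (p + 1) → G, (∀ k, f (J k) ∈ (U : Set Gf) * Q) →
          (∃ x : X, ∀ k, ∃ b ∈ 𝔖, θ (J k) • b • x₀ = x) →
          ∃ J₀ ∈ S, ∃ g : G, f g ∈ U ∧ ∀ k, g * J₀ k = J k) := by
  obtain ⟨Q, hQc, hQ⟩ := hcovH
  refine ⟨Q, hQc, fun x => ?_, fun p => ?_⟩
  · -- (a) the translates cover `X`
    obtain ⟨h, rfl⟩ := htrans x
    obtain ⟨γ, hγQ, b, hb, k, hk, rfl⟩ := hQ h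
    refine ⟨γ, Set.mem_mul.2 ⟨1, U.one_mem, f γ, hγQ, one_mul _⟩, b, hb, ?_⟩
    rw [mul_smul, mul_smul, hKc k hk]
  · -- (b) finitely many orbits of `p`-simplices
    have hUQc : IsCompact ((U : Set Gf) * Q) := hUc.mul hQc
    -- Step 1: finitely many representatives `ρ` of the cosets `U (f γ)`, `f γ ∈ U Q`
    obtain ⟨R₀, hR₀f, hR₀⟩ := exists_finite_rightCosetReps f U hUo hUQc
    -- Step 2: the finite set of ratios given by the Siegel property for `(U Q)⁻¹ (U Q)`
    obtain ⟨R, hRf, hR⟩ : ∃ R : Set G, R.Finite ∧ ∀ η : G,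
        f η ∈ ((U : Set Gf) * Q)⁻¹ * ((U : Set Gf) * Q) →
        (∃ b ∈ 𝔖, ∃ b' ∈ 𝔖, ∃ k ∈ Kc, θ η * b = b' * k) → η ∈ R :=
      ⟨_, hfinH _ (hUQc.inv.mul hUQc), fun _ h₁ h₂ => ⟨h₁, h₂⟩⟩
    -- Step 3: the finite set of base tuples `k ↦ ρ * η k`, `ρ ∈ R₀`, `η k ∈ R`
    obtain ⟨S, hSf, hS⟩ : ∃ S : Set (Fin (p + 1) → G), S.Finite ∧
        ∀ ρ ∈ R₀, ∀ η : Fin (p + 1) → G, (∀ k, η k ∈ R) → (fun k => ρ * η k) ∈ S :=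
      ⟨(fun q : G × (Fin (p + 1) → G) => fun k => q.1 * q.2 k) ''
          (R₀ ×ˢ Set.pi Set.univ fun _ => R),
        (hR₀f.prod (Set.Finite.pi fun _ => hRf)).image _,
        fun ρ hρ η hη => ⟨(ρ, η), ⟨hρ, fun k _ => hη k⟩, rfl⟩⟩
    refine ⟨S, hSf, ?_⟩
    -- Step 4: every tuple with a common point is a `U`-translate of a base tuple
    rintro J hJ ⟨x, hx⟩
    choose b hb𝔖 hbx using hx
    obtain ⟨ρ, hρ, hgU⟩ := hR₀ (J 0) (hJ 0)
    have hη : ∀ k, (J 0)⁻¹ * J k ∈ R := by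
      intro k
      refine hR _ ?_ ⟨b k, hb𝔖 k, b 0, hb𝔖 0, (b 0)⁻¹ * (θ ((J 0)⁻¹ * J k) * b k),
        hstab _ ?_, (mul_inv_cancel_left _ _).symm⟩
      · rw [map_mul, map_inv]
        exact Set.mem_mul.2 ⟨_, Set.inv_mem_inv.2 (hJ 0), _, hJ k, rfl⟩
      · rw [map_mul, map_inv, mul_smul, mul_smul, mul_smul, hbx k, ← hbx 0, inv_smul_smul,
          inv_smul_smul]
    refine ⟨fun k => ρ * ((J 0)⁻¹ * J k), hS ρ hρ _ hη, J 0 * ρ⁻¹, hgU, fun k => ?_⟩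
    rw [mul_assoc, inv_mul_cancel_left, mul_inv_cancel_left]

end SiegelCover

end Literature.NumberTheory.Automorphic
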